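import Literature.Computability.AlgebraicComplexity.SingleProductExchange
import HarnessLib

/-!
# `R(⟨2,2,n⟩ | X ∈ span(I, E₀₁)) ≥ 3n`: the dual-number plane ("J-orbit") cap of the ω-census

New work of the pub-omega census (ENG2 seat), topic `Summits/MatrixMultiplication/OmegaCensus`.
Framing: lottery ticket; floor = certified bounds/negative ranges. This is a kernel leg for ONE
number of a cap table (pub-omega-eng2/results/xcaps/DERIVATION.md, rule (G), 'dual' plane), not a
result about ω.

The object. Restricting the `2×2` by `2×n` matrix product `(X, Y) ↦ XY` to `X` in the plane
`span(I, E₀₁)` (`E₀₁ Y` moves row `1` of `Y` to row `0` and kills row `1`) gives the bilinear map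
`dualPlaneMul n : (s, Y) ↦ s 0 • Y + s 1 • N Y`, `N = dualShift n`; it is the structure map of the
module `(k[ε]/ε²)^n` over the dual numbers. Up to the `GL₂ × GL₂` action this plane is the
'J-orbit' of the census tables (32 of the 130 planes of `M₂(𝔽₃)`, 9 of 35 over `𝔽₂`).

The theorem (`three_mul_le_card`). Every bilinear computation (Bläser 2003, Def. 1; tree structure
`BilinComp`) of `dualPlaneMul n` over any field has length `≥ 3n`.

Proof (ENG2's module argument, DERIVATION.md §2, 'dual' case). Let `K₀ = ker N` (`= im N`,
dimension `n`). The second forms `g_i` have no common zero on `K₀ ∖ 0` (indeed on `V ∖ 0`: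
`φ(e₀, Y) = Y`), so (`exists_subset_forall_exists_eq`) some `J'` of them restrict to a basis-like
family of `K₀*`: no common zero on `K₀`, and `Y ↦ (g_j Y)_{j∈J'}` maps `K₀` onto `k^{J'}`, whence
`|J'| ≤ n`. Put `K = ⋂_{j∈J'} ker g_j`, so `dim K ≥ 2n − |J'|` and `K ∩ K₀ = 0`. Restricting `Y`
to `K` kills the products in `J'` (`BilinComp.restrictDrop` on the flipped computation), and the
`|ι| − |J'|` remaining output vectors span a space containing `φ(e₀, K) = K` and `φ(e₁, K) = N K`.
Since `N K ⊆ im N ⊆ ker N = K₀` meets `K` trivially and `N` is injective on `K`,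
`dim (K + N K) = 2 dim K ≥ 2(2n − |J'|)`. Hence `|ι| − |J'| ≥ 4n − 2|J'|`, i.e. `|ι| ≥ 4n − |J'| ≥ 3n`.
-/

namespace Summit.MatrixMultiplication.OmegaCensus.SmallFormats

open Module Literature.Computability.AlgebraicComplexity

variable {k : Type*} [Field k]

/-- The nilpotent shift `N = E₀₁` acting on `2×n` matrices: `(N Y) 0 = Y 1`, `(N Y) 1 = 0`. -/
def dualShift (n : ℕ) : (Fin 2 → Fin n → k) →ₗ[k] (Fin 2 → Fin n → k) where
  toFun Y i := if i = 0 then Y 1 else 0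
  map_add' Y Z := by
    funext i
    by_cases h : i = 0 <;> simp [h]
  map_smul' c Y := by
    funext i
    by_cases h : i = 0 <;> simp [h]

/-- `(N Y) 0 = Y 1`. -/
@[simp] theorem dualShift_apply_zero (n : ℕ) (Y : Fin 2 → Fin n → k) :
    dualShift n Y 0 = Y 1 := by
  simp [dualShift]

/-- `(N Y) 1 = 0`. -/
@[simp] theorem dualShift_apply_one (n : ℕ) (Y : Fin 2 → Fin n → k) :
    dualShift n Y 1 = 0 := by
  simp [dualShift]

/-- `N² = 0`. -/
theorem dualShift_dualShift (n : ℕ) (Y : Fin 2 → Fin n → k) :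
    dualShift n (dualShift n Y) = 0 := by
  funext i
  by_cases h : i = 0
  · subst h; simp
  · have h1 : i = 1 := by omega
    subst h1; simp

/-- The dual-number plane product `φ(s, Y) = s 0 • Y + s 1 • N Y`, i.e. `(X, Y) ↦ XY` for
`X = s 0 • I + s 1 • E₀₁ ∈ span(I, E₀₁) ⊂ M₂(k)`, `Y ∈ k^{2×n}`. -/
def dualPlaneMul (n : ℕ) : (Fin 2 → k) →ₗ[k] (Fin 2 → Fin n → k) →ₗ[k] (Fin 2 → Fin n → k) :=
  LinearMap.mk₂ k (fun s Y => s 0 • Y + s 1 • dualShift n Y)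
    (fun s t Y => by
      simp only [Pi.add_apply, add_smul]
      abel)
    (fun c s Y => by
      simp only [Pi.smul_apply, smul_eq_mul, mul_smul, smul_add])
    (fun s Y Z => by
      simp only [map_add, smul_add]
      abel)
    (fun c s Y => by
      simp only [map_smul, smul_comm (s 0) c, smul_comm (s 1) c, smul_add])

/-- Unfolding `dualPlaneMul`. -/
@[simp] theorem dualPlaneMul_apply (n : ℕ) (s : Fin 2 → k) (Y : Fin 2 → Fin n → k) :
    dualPlaneMul n s Y = s 0 • Y + s 1 • dualShift n Y := rfl

/-- `φ(e₀, Y) = Y`. -/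
theorem dualPlaneMul_single_zero (n : ℕ) (Y : Fin 2 → Fin n → k) :
    dualPlaneMul n (Pi.single 0 1) Y = Y := by
  simp

/-- `φ(e₁, Y) = N Y`. -/
theorem dualPlaneMul_single_one (n : ℕ) (Y : Fin 2 → Fin n → k) :
    dualPlaneMul n (Pi.single 1 1) Y = dualShift n Y := by
  simp

/-- `dim k^{2×n} = 2n`. -/
theorem finrank_two_by (n : ℕ) : finrank k (Fin 2 → Fin n → k) = 2 * n := by
  rw [Module.finrank_pi_fintype k]
  simp [Finset.sum_const]

/-- `dim ker N ≤ n` (`Y ↦ Y 0` is injective on `ker N`, where `Y 1 = (N Y) 0 = 0`). -/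
theorem finrank_ker_dualShift_le (n : ℕ) :
    finrank k (LinearMap.ker (dualShift (k := k) n)) ≤ n := by
  let π : (Fin 2 → Fin n → k) →ₗ[k] (Fin n → k) :=
    { toFun := fun Y => Y 0, map_add' := fun _ _ => rfl, map_smul' := fun _ _ => rfl }
  let ρ : LinearMap.ker (dualShift (k := k) n) →ₗ[k] (Fin n → k) := π.comp (LinearMap.ker _).subtype
  have hρ : Function.Injective ρ := by
    intro Y Z hYZ
    apply Subtype.ext
    funext i
    by_cases h : i = 0
    · subst h; exact hYZ
    · have h1 : i = 1 := by omega
      subst h1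
      have hY : dualShift n (Y : Fin 2 → Fin n → k) 0 = 0 := by
        have := Y.2; rw [LinearMap.mem_ker] at this; simp only [this, Pi.zero_apply]
      have hZ : dualShift n (Z : Fin 2 → Fin n → k) 0 = 0 := by
        have := Z.2; rw [LinearMap.mem_ker] at this; simp only [this, Pi.zero_apply]
      rw [dualShift_apply_zero] at hY hZ
      rw [hY, hZ]
  calc finrank k (LinearMap.ker (dualShift (k := k) n))
      ≤ finrank k (Fin n → k) := LinearMap.finrank_le_finrank_of_injective hρ
    _ = n := Module.finrank_fin_fun k

/-- **`R(⟨2,2,n⟩ | X ∈ span(I, E₀₁)) ≥ 3n`** (ENG2 module lemma, dual-number plane): every bilinear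
computation of `dualPlaneMul n` has at least `3n` products. -/
theorem three_mul_le_card {ι : Type*} [Fintype ι] [DecidableEq ι] (n : ℕ)
    (β : BilinComp (dualPlaneMul (k := k) n) ι) : 3 * n ≤ Fintype.card ι := by
  classical
  let N : (Fin 2 → Fin n → k) →ₗ[k] (Fin 2 → Fin n → k) := dualShift n
  let K₀ : Submodule k (Fin 2 → Fin n → k) := LinearMap.ker N
  -- (1) the second forms have no common zero on `K₀ ∖ 0` (even on `V ∖ 0`)
  have hcz : ∀ v ∈ K₀, (∀ j ∈ (Finset.univ : Finset ι), β.g j v = 0) → v = 0 := by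
    intro v _ h0
    have h := β.map_eq_sum (Pi.single 0 1) v
    rw [dualPlaneMul_single_zero] at h
    rw [h]
    exact Finset.sum_eq_zero fun i _ => by simp [h0 i (Finset.mem_univ _)]
  -- (2) a subfamily `J'` restricting to a 'basis' of `K₀*`
  obtain ⟨J', -, hinj, hsurj⟩ := BilinComp.exists_subset_forall_exists_eq K₀ Finset.univ β.g hcz
  -- (3) `|J'| ≤ n`
  have hJ'le : J'.card ≤ n := by
    let T₀ : K₀ →ₗ[k] (J' → k) := LinearMap.pi fun j => (β.g j).comp K₀.subtype
    have hT₀ : Function.Surjective T₀ := by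
      intro c
      obtain ⟨v, hv, hvc⟩ := hsurj fun j => if h : j ∈ J' then c ⟨j, h⟩ else 0
      refine ⟨⟨v, hv⟩, ?_⟩
      funext j
      have := hvc j j.2
      simp only [dif_pos j.2] at this
      simpa [T₀] using this
    have h1 : finrank k (J' → k) ≤ finrank k K₀ := by
      have := LinearMap.finrank_range_le T₀
      rwa [LinearMap.range_eq_top.2 hT₀, finrank_top] at this
    have h2 : finrank k (J' → k) = J'.card := by
      rw [Module.finrank_fintype_fun_eq_card, Fintype.card_coe]
    have h3 : finrank k K₀ ≤ n := finrank_ker_dualShift_le (k := k) n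
    omega
  -- (4) `K = ⋂_{j ∈ J'} ker g_j` as the kernel of `T : V → k^{J'}`
  let T : (Fin 2 → Fin n → k) →ₗ[k] (J' → k) := LinearMap.pi fun j => β.g j
  let K : Submodule k (Fin 2 → Fin n → k) := LinearMap.ker T
  have hmemK : ∀ {v}, v ∈ K ↔ ∀ j ∈ J', β.g j v = 0 := by
    intro v
    constructor
    · intro hv j hj
      have := congrFun (LinearMap.mem_ker.1 hv) ⟨j, hj⟩
      simpa [T] using this
    · intro h
      rw [LinearMap.mem_ker]
      funext j
      simpa [T] using h j j.2
  -- `dim K ≥ 2n − |J'|`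
  have hKdim : 2 * n ≤ finrank k K + J'.card := by
    have h1 : finrank k (LinearMap.range T) + finrank k K = finrank k (Fin 2 → Fin n → k) :=
      LinearMap.finrank_range_add_finrank_ker T
    have h2 : finrank k (LinearMap.range T) ≤ finrank k (J' → k) := Submodule.finrank_le _
    have h3 : finrank k (J' → k) = J'.card := by
      rw [Module.finrank_fintype_fun_eq_card, Fintype.card_coe]
    have h4 := finrank_two_by (k := k) n
    omega
  -- `K ∩ K₀ = 0`
  have hKK₀ : K ⊓ K₀ = ⊥ := by
    rw [eq_bot_iff]
    intro v hv
    rw [Submodule.mem_bot]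
    exact hinj v hv.2 (hmemK.1 hv.1)
  -- (5) kill the products in `J'` by restricting the second argument to `K`
  have hJK : ∀ i ∈ J', ∀ u ∈ K, β.flip.f i u = 0 := by
    intro i hi u hu
    rw [BilinComp.flip_f]
    exact hmemK.1 hu i hi
  let β' := β.flip.restrictDrop K J' hJK
  let S : Submodule k (Fin 2 → Fin n → k) := Submodule.span k (Set.range β'.w)
  -- every value `φ(s, y)`, `y ∈ K`, lies in the span of the remaining output vectors
  have hval : ∀ (y : K) (s : Fin 2 → k), dualPlaneMul n s (y : Fin 2 → Fin n → k) ∈ S := by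
    intro y s
    have h := β'.map_eq_sum y s
    have h' : ((dualPlaneMul (k := k) n).flip.comp K.subtype) y s = dualPlaneMul n s y := rfl
    rw [h'] at h
    rw [h]
    exact Submodule.sum_mem _ fun i _ =>
      Submodule.smul_mem _ _ (Submodule.subset_span ⟨i, rfl⟩)
  have hKS : K ≤ S := by
    intro y hy
    have := hval ⟨y, hy⟩ (Pi.single 0 1)
    rwa [dualPlaneMul_single_zero] at this
  have hNKS : K.map N ≤ S := by
    rintro _ ⟨y, hy, rfl⟩
    have := hval ⟨y, hy⟩ (Pi.single 1 1)
    rwa [dualPlaneMul_single_one] at this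
  -- (6) `N K ≤ K₀`, so `K ∩ N K = 0`
  have hNKK₀ : K.map N ≤ K₀ := by
    rintro _ ⟨y, _, rfl⟩
    change dualShift n (dualShift n y) = 0
    exact dualShift_dualShift n y
  have hKNK : K ⊓ K.map N = ⊥ := by
    rw [eq_bot_iff]
    calc K ⊓ K.map N ≤ K ⊓ K₀ := inf_le_inf_left _ hNKK₀
      _ = ⊥ := hKK₀
  -- (7) `dim N K = dim K` (`N` is injective on `K`)
  have hNinj : Function.Injective (N.domRestrict K) := by
    rw [← LinearMap.ker_eq_bot, eq_bot_iff]
    intro y hy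
    rw [Submodule.mem_bot]
    have hy0 : N y = 0 := by simpa using hy
    have : (y : Fin 2 → Fin n → k) ∈ K ⊓ K₀ := ⟨y.2, hy0⟩
    rw [hKK₀, Submodule.mem_bot] at this
    exact Subtype.ext this
  have hmapdim : finrank k (K.map N) = finrank k K := by
    rw [← LinearMap.range_domRestrict]
    exact LinearMap.finrank_range_of_inj hNinj
  -- (8) `dim (K + N K) = 2 dim K ≤ dim S ≤ |ι| − |J'|`
  have hsup : finrank k ↥(K ⊔ K.map N) = finrank k K + finrank k (K.map N) := by
    have := Submodule.finrank_sup_add_finrank_inf_eq K (K.map N)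
    rw [hKNK, finrank_bot] at this
    omega
  have hsupS : finrank k ↥(K ⊔ K.map N) ≤ finrank k S :=
    Submodule.finrank_mono (sup_le hKS hNKS)
  have hS : finrank k S ≤ Fintype.card {i // i ∉ J'} := finrank_range_le_card β'.w
  have hcard : Fintype.card {i // i ∉ J'} = Fintype.card ι - J'.card :=
    BilinComp.card_restrictDrop_index J'
  have hJ'card : J'.card ≤ Fintype.card ι := Finset.card_le_univ J'
  omega

end Summit.MatrixMultiplication.OmegaCensus.SmallFormats
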